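import Mathlib.Algebra.CharP.Lemmas
import Mathlib.FieldTheory.Finite.Basic
import Mathlib.RingTheory.Polynomial.Basic
import HarnessLib

/-!
# The Artin–Schreier idempotents `e_k(s) = 1 - (s - k)^(p-1)` of a solution of `s ^ p = s`

In a commutative `𝔽_p`-algebra `A` (`CharP A p`, `p` prime), an element `s` with `s ^ p = s`
generates a subalgebra `𝔽_p[s] ≅ 𝔽_p[T]/(h)` with `h ∣ T^p - T = ∏_{k ∈ 𝔽_p} (T - k)`, hence a
product of copies of `𝔽_p`; concretely, the elements `e_k(s) = 1 - (s - k)^{p-1}`, `k ∈ ℤ/p`, are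
orthogonal idempotents with `s · e_k = k · e_k`. This is the algebra behind the description of the
kernel of `F - 1 : 𝔾ₐ → 𝔾ₐ` on the étale (indeed Zariski) site as the locally constant
`ℤ/p`-valued functions (Milne II 2.18 (c): `(ℤ/pℤ)_X(U) = {a ∈ Γ(U, 𝓞_U) | a^p - a = 0}`), used in
the exactness of the Artin–Schreier sequence (`EtaleArtinSchreier*.lean`). Everything is proved:

* `sub_zmodCast_pow_prime` : `(s - k)^p = s - k`;
* `sub_zmodCast_mul_artinSchreierIdem` : `(s - k) e_k = 0`, i.e. `s e_k = k e_k`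
  (`mul_artinSchreierIdem`);
* `artinSchreierIdem_mul_self` : `e_k² = e_k`;
* `artinSchreierIdem_mul_artinSchreierIdem_of_ne` : `e_l e_k = 0` for `k ≠ l`
  (via `(s - l)^n e_k = (k - l)^n e_k` and Fermat `(k - l)^{p-1} = 1`);
* `exists_eq_zmodCast_of_pow_eq_prime` : in a field of characteristic `p`, `t ^ p = t` iff `t ∈ 𝔽_p`
  (the `p` elements of the prime field exhaust the roots of `T^p - T`).

## References

* J. S. Milne, *Étale cohomology*, Princeton (reissue 2025; held copy, PDF pages): II Examples
  2.18 (c) (pp. 74–75: `(ℤ/pℤ)_X ≈ (spec 𝔽_p[T]/(T^p - T))_X`, `(ℤ/pℤ)_X(U) = {a | a^p = a}`).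
  [Milne2025]

## Design notes

* No definition is introduced: the idempotent is written out as
  `1 - (s - ZMod.castHom (dvd_refl p) A k) ^ (p - 1)` in every statement (the file is pure
  proofs). `A` is assumed `CharP A p` (so non-zero when `p` is prime); users split off the zero
  ring.
* Mathlib searches: `sub_pow_char`, `ZMod.pow_card`, `ZMod.pow_card_sub_one_eq_one`,
  `FiniteField.roots_X_pow_card_sub_X`, `Polynomial.map_roots_le`; no statement about the
  solutions of `x^p = x` in an `𝔽_p`-algebra or their idempotents in Mathlib. Nothing restated.
-/

open Polynomial

namespace Literature.RingTheory.Idempotents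

section Idempotents

variable {A : Type*} [CommRing A] {p : ℕ} [hp : Fact p.Prime] [CharP A p]

/-- `(s - k)^p = s - k` for `s ^ p = s` and `k ∈ 𝔽_p` (Frobenius is additive and fixes `𝔽_p`).
[folklore] -/
theorem sub_zmodCast_pow_prime {s : A} (hs : s ^ p = s) (k : ZMod p) :
    (s - ZMod.castHom (dvd_refl p) A k) ^ p = s - ZMod.castHom (dvd_refl p) A k := by
  rw [sub_pow_char, hs, ← map_pow, ZMod.pow_card]

/-- `(s - k) · e_k(s) = 0` where `e_k(s) = 1 - (s - k)^{p-1}`. [folklore] -/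
theorem sub_zmodCast_mul_artinSchreierIdem {s : A} (hs : s ^ p = s) (k : ZMod p) :
    (s - ZMod.castHom (dvd_refl p) A k) *
      (1 - (s - ZMod.castHom (dvd_refl p) A k) ^ (p - 1)) = 0 := by
  have hp1 : p - 1 + 1 = p := Nat.sub_add_cancel hp.out.one_lt.le
  rw [mul_sub, mul_one, ← pow_succ', hp1, sub_zmodCast_pow_prime hs, sub_self]

/-- `s · e_k(s) = k · e_k(s)`: on the "piece" cut out by the idempotent `e_k(s)`, `s` is the
constant `k` (Milne II 2.18 (c)). [cite: Milne2025, II Examples 2.18 (c)] -/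
theorem mul_artinSchreierIdem {s : A} (hs : s ^ p = s) (k : ZMod p) :
    s * (1 - (s - ZMod.castHom (dvd_refl p) A k) ^ (p - 1)) =
      ZMod.castHom (dvd_refl p) A k * (1 - (s - ZMod.castHom (dvd_refl p) A k) ^ (p - 1)) := by
  have := sub_zmodCast_mul_artinSchreierIdem hs k
  rw [sub_mul, sub_eq_zero] at this
  exact this

/-- `e_k(s)` is idempotent. [folklore] -/
theorem artinSchreierIdem_mul_self {s : A} (hs : s ^ p = s) (k : ZMod p) :
    (1 - (s - ZMod.castHom (dvd_refl p) A k) ^ (p - 1)) *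
        (1 - (s - ZMod.castHom (dvd_refl p) A k) ^ (p - 1)) =
      1 - (s - ZMod.castHom (dvd_refl p) A k) ^ (p - 1) := by
  have hp2 : p - 1 = (p - 2) + 1 := by have := hp.out.two_le; omega
  have h : (s - ZMod.castHom (dvd_refl p) A k) ^ (p - 1) *
      (1 - (s - ZMod.castHom (dvd_refl p) A k) ^ (p - 1)) = 0 := by
    have e1 : (s - ZMod.castHom (dvd_refl p) A k) ^ (p - 1) =
        (s - ZMod.castHom (dvd_refl p) A k) ^ (p - 2) * (s - ZMod.castHom (dvd_refl p) A k) := by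
      conv_lhs => rw [hp2, pow_succ]
    nth_rewrite 1 [e1]
    rw [mul_assoc, sub_zmodCast_mul_artinSchreierIdem hs, mul_zero]
  rw [sub_mul, one_mul, h, sub_zero]

/-- `(s - l)^n · e_k(s) = (k - l)^n · e_k(s)`. [folklore] -/
theorem sub_zmodCast_pow_mul_artinSchreierIdem {s : A} (hs : s ^ p = s) (k l : ZMod p) (n : ℕ) :
    (s - ZMod.castHom (dvd_refl p) A l) ^ n *
        (1 - (s - ZMod.castHom (dvd_refl p) A k) ^ (p - 1)) =
      (ZMod.castHom (dvd_refl p) A k - ZMod.castHom (dvd_refl p) A l) ^ n *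
        (1 - (s - ZMod.castHom (dvd_refl p) A k) ^ (p - 1)) := by
  set e := 1 - (s - ZMod.castHom (dvd_refl p) A k) ^ (p - 1) with he
  set ck := ZMod.castHom (dvd_refl p) A k
  set cl := ZMod.castHom (dvd_refl p) A l
  induction n with
  | zero => simp
  | succ n ih =>
    have h1 : (s - cl) * e = (ck - cl) * e := by
      rw [sub_mul, sub_mul, he, mul_artinSchreierIdem hs]
    calc (s - cl) ^ (n + 1) * e
        = (s - cl) ^ n * ((s - cl) * e) := by ring
      _ = (s - cl) ^ n * ((ck - cl) * e) := by rw [h1]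
      _ = (ck - cl) * ((s - cl) ^ n * e) := by ring
      _ = (ck - cl) * ((ck - cl) ^ n * e) := by rw [ih]
      _ = (ck - cl) ^ (n + 1) * e := by ring

/-- **The `e_k(s)` are orthogonal**: `e_l(s) · e_k(s) = 0` for `k ≠ l` (Fermat:
`(k - l)^{p-1} = 1` in `𝔽_p`). [folklore] -/
theorem artinSchreierIdem_mul_artinSchreierIdem_of_ne {s : A} (hs : s ^ p = s) {k l : ZMod p}
    (hkl : k ≠ l) :
    (1 - (s - ZMod.castHom (dvd_refl p) A l) ^ (p - 1)) *
      (1 - (s - ZMod.castHom (dvd_refl p) A k) ^ (p - 1)) = 0 := by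
  have h : (s - ZMod.castHom (dvd_refl p) A l) ^ (p - 1) *
      (1 - (s - ZMod.castHom (dvd_refl p) A k) ^ (p - 1)) =
        1 - (s - ZMod.castHom (dvd_refl p) A k) ^ (p - 1) := by
    rw [sub_zmodCast_pow_mul_artinSchreierIdem hs, ← map_sub, ← map_pow,
      ZMod.pow_card_sub_one_eq_one (sub_ne_zero.2 hkl), map_one, one_mul]
  rw [sub_mul, one_mul, h, sub_self]

end Idempotents

section Field

variable {F : Type*} [Field F] {p : ℕ} [hp : Fact p.Prime] [CharP F p]

/-- **In a field of characteristic `p`, the solutions of `t ^ p = t` are exactly the `p` elements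
of the prime field** `𝔽_p ⊆ F` (they are `p` distinct roots of `T^p - T`, which has at most `p`
roots). [folklore] -/
theorem exists_eq_zmodCast_of_pow_eq_prime {t : F} (ht : t ^ p = t) :
    ∃ k : ZMod p, t = ZMod.castHom (dvd_refl p) F k := by
  classical
  set f : F[X] := X ^ p - X with hf
  have hf0 : f ≠ 0 := FiniteField.X_pow_card_sub_X_ne_zero F hp.out.one_lt
  have hroot : t ∈ f.roots := by
    rw [mem_roots hf0, IsRoot.def, hf, eval_sub, eval_pow, eval_X, ht, sub_self]
  set g : (ZMod p)[X] := X ^ p - X with hg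
  have hmap : g.map (ZMod.castHom (dvd_refl p) F) = f := by
    rw [hg, hf, Polynomial.map_sub, Polynomial.map_pow, map_X]
  have hle : (g.roots.map (ZMod.castHom (dvd_refl p) F)) ≤ f.roots := by
    rw [← hmap]
    exact map_roots_le (by rw [hmap]; exact hf0)
  have hgroots : g.roots = Finset.univ.val := by
    have h := FiniteField.roots_X_pow_card_sub_X (ZMod p)
    rw [ZMod.card] at h
    rw [hg]
    exact h
  have hcard : Multiset.card f.roots ≤ p := by
    calc Multiset.card f.roots ≤ f.natDegree := card_roots' f
      _ = p := by
        rw [hf]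
        exact FiniteField.X_pow_card_sub_X_natDegree_eq F hp.out.one_lt
  have hcard' : Multiset.card (g.roots.map (ZMod.castHom (dvd_refl p) F)) = p := by
    rw [Multiset.card_map, hgroots, Finset.card_val, Finset.card_univ, ZMod.card]
  have heq : g.roots.map (ZMod.castHom (dvd_refl p) F) = f.roots :=
    Multiset.eq_of_le_of_card_le hle (by rw [hcard']; exact hcard)
  rw [← heq, Multiset.mem_map] at hroot
  obtain ⟨k, -, hk⟩ := hroot
  exact ⟨k, hk.symm⟩

end Field

end Literature.RingTheory.Idempotents
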